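import Summits.ResolutionOfSingularities.ResolutionOfSingularities.Theses.UniformComplexity
import Summits.ResolutionOfSingularities.ResolutionOfSingularities.Theorems.UniformComplexityCampaignW82AlgClosedStep
import Summits.ResolutionOfSingularities.ResolutionOfSingularities.Theorems.UniformComplexityPrimeModelTransferSpecialization
import Summits.ResolutionOfSingularities.ResolutionOfSingularities.Theorems.UniformComplexityPrimeModelTransferSpecializationGraded
import Summits.ResolutionOfSingularities.ResolutionOfSingularities.Theorems.UniformComplexityPrimeModelTransferAlgClosedTower
import Mathlib.FieldTheory.IsAlgClosed.Basic
import HarnessLib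

/-!
# Crux `PrimeModelTransfer` (stmt-ResolutionOfSingularities-8933), door 2 of slot W8.2:
# the lane-signed OURS statements of the specialization campaign, PROVED BY NAME

Route `ResolutionOfSingularities/UniformComplexity`. The typer res-L1-type-o6 filed the OURS names
`CampaignW82.Specialization p`, `SpecializationDimLe p n`, `PrimeClosureRes p`, `AlgClosedRes p`,
`PrimeModelTransferAt p` (Theorems/UniformComplexityCampaignW82SpecializationNormalForms.lean,
p481773) and `ClimbAlgClosedStep p`, `AlgClosedAllOrNothing p` (+ graded forms;
Theorems/UniformComplexityCampaignW82AlgClosedStep.lean, p486396, lanes A/B signed). This leaf file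
proves them / their equivalences BY NAME from the prover's theorems (p484634, p487796; the three
auxiliary lemmas of the leaf file `…SpecializationLinks.lean`, p485462, are re-proved privately
here so that this file builds only on Theses-free modules besides the route file itself):

* `CampaignW82.specialization_holds : Specialization p` and
  `CampaignW82.specializationDimLe_holds : SpecializationDimLe p n` — THE SPECIALIZATION THEOREM and
  its dimension-graded form, as typed (`integralResOver_of_integralResOver_extension`,
  `integralResUpToDim_of_integralResUpToDim_extension`);
* `CampaignW82.primeModelTransfer_iff_forall_primeModelTransferAt` (pure logic);
* `CampaignW82.primeModelTransferAt_iff_algClosedAllOrNothing` — per prime: the crux slice is the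
  ALL-OR-NOTHING form; `CampaignW82.primeModelTransferAt_iff_climbAlgClosedStep` — per prime: the
  crux slice is the ONE-STEP CLIMB between algebraically closed fields (the exact residual);
* `CampaignW82.primeModelTransfer_iff_forall_algClosedAllOrNothing`,
  `CampaignW82.primeModelTransfer_iff_forall_climbAlgClosedStep` — the same for the route decl
  `UniformComplexity.PrimeModelTransfer`.

[OURS · LADDER-RESOLUTION L1, slot W8.2 (prime-field / universality transfer), door 2
UniformComplexity] By-name links; NOT statements of, and attributing nothing to, Hironaka's 2017
manuscript. AI-written; weaker than expert review.
-/

noncomputable section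

set_option linter.dupNamespace false -- mandated namespace of this single-conjunct summit

open CategoryTheory CategoryTheory.Limits AlgebraicGeometry TopologicalSpace
open Literature.AlgebraicGeometry.Resolution
open Summit.ResolutionOfSingularities.ResolutionOfSingularities.Theses.UniformComplexity (PrimeModelTransfer)


namespace Summit.ResolutionOfSingularities.ResolutionOfSingularities.Theorems.CampaignW82

/-! ## Private copies of the auxiliary lemmas of `…SpecializationLinks.lean` (Theses-free content) -/

/-- The crux's algebraicity clause implies algebraicity over `ZMod p`. [folklore] -/
private theorem isAlgebraic_of_forall_pow_prime_pow_eq_self' (p : ℕ) [Fact p.Prime] (k : Type)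
    [Field k] [CharP k p] [Algebra (ZMod p) k] (hk : ∀ x : k, ∃ n : ℕ, 0 < n ∧ x ^ p ^ n = x) :
    Algebra.IsAlgebraic (ZMod p) k := by
  refine ⟨fun x => ?_⟩
  obtain ⟨n, hn, hx⟩ := hk x
  have hdeg : 1 < p ^ n := Nat.one_lt_pow hn.ne' (Fact.out : p.Prime).one_lt
  refine ⟨Polynomial.X ^ (p ^ n) - Polynomial.X, ?_, ?_⟩
  · intro h
    have := congrArg Polynomial.natDegree h
    rw [Polynomial.natDegree_sub_eq_left_of_natDegree_lt (by simpa using hdeg),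
      Polynomial.natDegree_X_pow, Polynomial.natDegree_zero] at this
    exact (Nat.pos_of_ne_zero (by omega) |>.ne') this |>.elim
  · simp [hx]

/-- The crux hypothesis from resolution over any algebraically closed field of characteristic
`p` (specialization along `IsAlgClosed.lift : k → M`). [folklore] -/
private theorem primeClosureRes_of_isAlgClosed (p : ℕ) [Fact p.Prime]
    (M : Type) [Field M] [CharP M p] [IsAlgClosed M]
    (hM : ∀ (X : Scheme.{0}) (f : X ⟶ Spec (.of M)), IsSeparated f → LocallyOfFiniteType f →
      QuasiCompact f → IsIntegral X → Scheme.HasResolution X) : PrimeClosureRes p := by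
  intro k _ _ _ hk X f hs hl hq hX
  letI : Algebra (ZMod p) k := ZMod.algebra k p
  letI : Algebra (ZMod p) M := ZMod.algebra M p
  haveI : Algebra.IsAlgebraic (ZMod p) k := isAlgebraic_of_forall_pow_prime_pow_eq_self' p k hk
  let ι : k →ₐ[ZMod p] M := IsAlgClosed.lift
  letI : Algebra k M := ι.toRingHom.toAlgebra
  haveI : PerfectField M := IsAlgClosed.perfectField M
  exact _root_.Summit.ResolutionOfSingularities.ResolutionOfSingularities.Theorems.PrimeModelTransfer.integralResOver_of_integralResOver_extension k M hM X f hs hl hq hX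

/-- The tower of algebraically closed subfields from the one-step climb (copy of
`PrimeModelTransfer.exists_isAlgClosed_subfield_hasResolution_of_step`, p485462). [folklore] -/
private theorem exists_isAlgClosed_subfield_of_step (p : ℕ) [Fact p.Prime]
    (K : Type) [Field K] [CharP K p] [IsAlgClosed K] (hA : PrimeClosureRes p)
    (hstep : ClimbAlgClosedStep p) (S : Finset K) :
    ∃ A : Subfield K, (↑S : Set K) ⊆ A ∧ IsAlgClosed A ∧
      ∀ (X : Scheme.{0}) (f : X ⟶ Spec (.of A)), IsSeparated f → LocallyOfFiniteType f →
        QuasiCompact f → IsIntegral X → Scheme.HasResolution X := by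
  classical
  letI : Algebra (ZMod p) K := ZMod.algebra K p
  induction S using Finset.induction_on with
  | empty =>
    let A₀ : IntermediateField (ZMod p) K := algebraicClosure (ZMod p) K
    haveI : IsAlgClosed A₀ := IsAlgClosure.isAlgClosed (ZMod p)
    haveI : CharP A₀ p := (algebraMap A₀ K).charP (algebraMap A₀ K).injective p
    have halg : ∀ x : A₀, ∃ n : ℕ, 0 < n ∧ x ^ p ^ n = x := fun x =>
      _root_.Summit.ResolutionOfSingularities.ResolutionOfSingularities.Theorems.PrimeModelTransfer.pow_prime_pow_eq_self_of_isAlgebraic p x (Algebra.IsAlgebraic.isAlgebraic x)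
    exact ⟨A₀.toSubfield, by simp, inferInstanceAs (IsAlgClosed A₀),
      fun X f hs hl hq hX => hA A₀ halg X f hs hl hq hX⟩
  | insert t S _ ih =>
    obtain ⟨A, hSA, hAc, hAres⟩ := ih
    haveI : IsAlgClosed A := hAc
    haveI : CharP A p := (algebraMap A K).charP (algebraMap A K).injective p
    let E : IntermediateField A K := IntermediateField.adjoin A ({t} : Set K)
    let L : IntermediateField E K := algebraicClosure E K
    haveI : IsAlgClosed L := IsAlgClosure.isAlgClosed E
    refine ⟨L.toSubfield, ?_, inferInstanceAs (IsAlgClosed L), ?_⟩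
    · have hEL : ∀ x : K, x ∈ E → x ∈ L.toSubfield := fun x hx => by
        have := L.algebraMap_mem ⟨x, hx⟩
        simpa using this
      rw [Finset.coe_insert, Set.insert_subset_iff]
      refine ⟨hEL t (IntermediateField.mem_adjoin_simple_self A t), fun x hx => hEL x ?_⟩
      exact E.algebraMap_mem (⟨x, hSA hx⟩ : A)
    · exact fun X f hs hl hq hX => hstep A hAres K t X f hs hl hq hX

end Summit.ResolutionOfSingularities.ResolutionOfSingularities.Theorems.CampaignW82

namespace Summit.ResolutionOfSingularities.ResolutionOfSingularities.Theorems.CampaignW82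

/-! ## The specialization theorem, by name -/

/-- **`CampaignW82.Specialization p` HOLDS** (every prime, indeed every `p`): resolution over a
perfect field `L` descends to every algebraically closed subfield `K`
(`PrimeModelTransfer.integralResOver_of_integralResOver_extension`, p484634; the typed statement's
`[CharP K p]` binder is not used). [folklore] -/
theorem specialization_holds (p : ℕ) : Specialization p :=
  fun K _ _ _ L _ _ _ hL X f hs hl hq hX =>
    _root_.Summit.ResolutionOfSingularities.ResolutionOfSingularities.Theorems.PrimeModelTransfer.integralResOver_of_integralResOver_extension K L hL X f hs hl hq hX

/-- **`CampaignW82.SpecializationDimLe p n` HOLDS** for every `p` and every dimension bound `n`: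
the dimension-graded specialization (`PrimeModelTransfer.integralResUpToDim_of_integralResUpToDim_extension`,
p487796, via `dim X_L = dim X`). [folklore] -/
theorem specializationDimLe_holds (p : ℕ) (n : WithBot ℕ∞) : SpecializationDimLe p n :=
  fun K _ _ _ L _ _ _ hL X f hs hl hq hX hd =>
    _root_.Summit.ResolutionOfSingularities.ResolutionOfSingularities.Theorems.PrimeModelTransfer.integralResUpToDim_of_integralResUpToDim_extension K L n hL X f hs hl hq hX hd

/-! ## The crux and its `p`-slices -/

/-- `PrimeModelTransfer` is the conjunction of its `p`-slices `PrimeModelTransferAt p`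
(definitional). [folklore] -/
theorem primeModelTransfer_iff_forall_primeModelTransferAt :
    PrimeModelTransfer ↔ ∀ p : ℕ, p.Prime → PrimeModelTransferAt p :=
  Iff.rfl

/-- **Per prime: the crux slice is the all-or-nothing form.** `PrimeModelTransferAt p ↔
AlgClosedAllOrNothing p` for prime `p` (→: the crux hypothesis `PrimeClosureRes p` follows from
`Res(M)` for any algebraically closed `M` of characteristic `p` by specialization along
`IsAlgClosed.lift : k → M`; ←: `𝔽̄_p` is such an `M`).
[folklore] -/
theorem primeModelTransferAt_iff_algClosedAllOrNothing {p : ℕ} (hp : p.Prime) :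
    PrimeModelTransferAt p ↔ AlgClosedAllOrNothing p := by
  haveI : Fact p.Prime := ⟨hp⟩
  constructor
  · intro h M _ _ _ hM
    exact h (primeClosureRes_of_isAlgClosed p M hM)
  · intro h hA
    let k₀ : Type := AlgebraicClosure (ZMod p)
    haveI : CharP k₀ p := charP_of_injective_algebraMap (algebraMap (ZMod p) k₀).injective p
    have hk₀ : ∀ x : k₀, ∃ n : ℕ, 0 < n ∧ x ^ p ^ n = x := fun x =>
      _root_.Summit.ResolutionOfSingularities.ResolutionOfSingularities.Theorems.PrimeModelTransfer.pow_prime_pow_eq_self_of_isAlgebraic p x (Algebra.IsAlgebraic.isAlgebraic x)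
    exact h k₀ (hA k₀ hk₀)

/-- **Per prime: the crux slice is the one-step climb between algebraically closed fields** (the
EXACT door-2 residual): `PrimeModelTransferAt p ↔ ClimbAlgClosedStep p` for prime `p`
(→: `climbAlgClosedStep_of_algClosedAllOrNothing` after the previous equivalence; ←: tower of
algebraically closed subfields and descent `PrimeModelTransfer.hasResolution_of_perfectSubfields`).
[folklore] -/
theorem primeModelTransferAt_iff_climbAlgClosedStep {p : ℕ} (hp : p.Prime) :
    PrimeModelTransferAt p ↔ ClimbAlgClosedStep p := by
  haveI : Fact p.Prime := ⟨hp⟩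
  constructor
  · intro h
    exact climbAlgClosedStep_of_algClosedAllOrNothing
      ((primeModelTransferAt_iff_algClosedAllOrNothing hp).mp h)
  · intro h hA K _ _ _ X f hs hl hq hX
    haveI : PerfectField K := IsAlgClosed.perfectField K
    refine _root_.Summit.ResolutionOfSingularities.ResolutionOfSingularities.Theorems.PrimeModelTransfer.hasResolution_of_perfectSubfields K (fun s => ?_) X f hs hl hq hX
    obtain ⟨A, hsA, hAc, hAres⟩ := exists_isAlgClosed_subfield_of_step p K hA h s
    haveI : IsAlgClosed A := hAc
    exact ⟨A, hsA, IsAlgClosed.perfectField A, hAres⟩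

/-- **`PrimeModelTransfer ⟺ ∀ p prime, AlgClosedAllOrNothing p`** (by name). [folklore] -/
theorem primeModelTransfer_iff_forall_algClosedAllOrNothing :
    PrimeModelTransfer ↔ ∀ p : ℕ, p.Prime → AlgClosedAllOrNothing p :=
  ⟨fun h p hp => (primeModelTransferAt_iff_algClosedAllOrNothing hp).mp (h p hp),
    fun h p hp => (primeModelTransferAt_iff_algClosedAllOrNothing hp).mpr (h p hp)⟩

/-- **`PrimeModelTransfer ⟺ ∀ p prime, ClimbAlgClosedStep p`** (by name): the crux is EQUIVALENT
to the one-step climb between algebraically closed fields — the re-based door-2 residual.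
[folklore] -/
theorem primeModelTransfer_iff_forall_climbAlgClosedStep :
    PrimeModelTransfer ↔ ∀ p : ℕ, p.Prime → ClimbAlgClosedStep p :=
  ⟨fun h p hp => (primeModelTransferAt_iff_climbAlgClosedStep hp).mp (h p hp),
    fun h p hp => (primeModelTransferAt_iff_climbAlgClosedStep hp).mpr (h p hp)⟩

/-- **`AlgClosedAllOrNothing p ⟺ ClimbAlgClosedStep p`** for prime `p` (both are the crux slice).
[folklore] -/
theorem algClosedAllOrNothing_iff_climbAlgClosedStep {p : ℕ} (hp : p.Prime) :
    AlgClosedAllOrNothing p ↔ ClimbAlgClosedStep p :=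
  (primeModelTransferAt_iff_algClosedAllOrNothing hp).symm.trans
    (primeModelTransferAt_iff_climbAlgClosedStep hp)

end Summit.ResolutionOfSingularities.ResolutionOfSingularities.Theorems.CampaignW82

end
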